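import Summits.Ventures.HSemireg.DerivedDescent
import HarnessLib

/-!
# `shiftedHomMap` and PRE-composition with a degree-`0` class

Cell `pub-hsemireg`, general-structure seat gs-g4; twin of `shiftedHomMap_comp_mk₀` (`HomComplexSigmaSingle.lean`, post-composition),
needed as step (s2) of the (I5-iso) assembly of general-structure/SIGMA-INVARIANCE-PLAN-gs-g4.md §6 (invariance of t-7's `σ_q^C` along an
isomorphism of strictly perfect complexes). Sequel to p3's `DerivedDescent.lean` (`derivedLift`, `derivedLiftFac`, `shiftedHomMap`).
HONEST FRAMING: generic Mathlib plumbing — NOT a door, NOT a named fact, NOT a «K2 result»; nothing here says HC, HC_CM or HC_AV is proved.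

* **`shiftedHomMap_mk₀_comp`** — `Φ_*(Q(g) · y) = Q(Φ g) · Φ_*(y)` for a chain map `g : A ⟶ A'` and `y : Q A' ⟶ (Q B)⟦n⟧`
  (naturality of the factorisation `Q ⋙ derivedLift Φ ≅ Φ ⋙ Q`).

## References
* Mathlib: `CategoryTheory.Localization` (`Lifting`), `ShiftedHom`; folklore.
-/

noncomputable section

open CategoryTheory CategoryTheory.Category

namespace Summit.Ventures.HSemireg

universe w' v' u'

variable {C : Type u'} [Category.{v'} C] [Abelian C] [HasDerivedCategory.{w'} C]
  (Φ : CochainComplex C ℤ ⥤ CochainComplex C ℤ) [Φ.CommShift ℤ]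
  (hΦ : (HomologicalComplex.quasiIso C (ComplexShape.up ℤ)).IsInvertedBy (Φ ⋙ DerivedCategory.Q))

set_option backward.isDefEq.respectTransparency false in
/-- **`shiftedHomMap` commutes with pre-composition by a degree-`0` class**: `Φ_*(Q(g) · y) = Q(Φ g) · Φ_*(y)`
(naturality of `derivedLiftFac⁻¹ : Φ ⋙ Q ⟶ Q ⋙ derivedLift Φ`). [folklore] -/
theorem shiftedHomMap_mk₀_comp {A A' B : CochainComplex C ℤ} {n : ℤ} (g : A ⟶ A')
    (y : ShiftedHom (DerivedCategory.Q.obj A') (DerivedCategory.Q.obj B) n) :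
    shiftedHomMap Φ hΦ ((ShiftedHom.mk₀ (0 : ℤ) rfl (DerivedCategory.Q.map g)).comp y (add_zero n)) =
      (ShiftedHom.mk₀ (0 : ℤ) rfl (DerivedCategory.Q.map (Φ.map g))).comp (shiftedHomMap Φ hΦ y) (add_zero n) := by
  have hnat : (derivedLiftFac Φ hΦ).inv.app A ≫ (derivedLift Φ hΦ).map (DerivedCategory.Q.map g) =
      DerivedCategory.Q.map (Φ.map g) ≫ (derivedLiftFac Φ hΦ).inv.app A' :=
    ((derivedLiftFac Φ hΦ).inv.naturality g).symm
  simp only [shiftedHomMap, ShiftedHom.mk₀_comp, ShiftedHom.map, Functor.map_comp]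
  simp only [assoc]
  rw [reassoc_of% hnat]

end Summit.Ventures.HSemireg

end
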